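import Summits.MatrixMultiplication.MatrixMultiplication.Theorems.SoloInformedWitness

/-!
# The transfer principle: translate-averaging, and LAZY ⟹ C3♯ for every chart

This work, §8.8 (gen 107). Setting of `SoloInformedFibreLines` / `SoloInformedWitness` (CohnUmans2013,
arXiv:1207.6528, Def. 12; coprime case, one involutory multiplier): twisted data `a b c : ι → ι → G` over the odd
part `G = S¹` with the triangle equations (E), a flat chart `(f, g, l) : ι → G₀` into the even part `G₀ = S⁰`
(fibres of `F(i,j,k) = f i + g j + l k`), and separation of every ordered pair of distinct triples in one fibre
(`Data.SepAll`). The rank of the scheme is `|S⁰| · r`, `r` = number of sign classes of `S¹`; a map `κ : G → R`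
with `κ x = κ y → SignEq x y` stands for "the class of".

* `card_mul_card_le_of_sub_mem_sub` — the TRANSLATE-AVERAGING LEMMA: if cells `x ≠ x'` whose chart values differ by
  an element of `T - T` always carry different classes, then `|X| · |T| ≤ |R| · |S|` for any finset `S ∋ φ x - t`
  (the map `(x, t) ↦ (class x, φ x - t)` is injective). This device turns every 'clique along a line' step of the
  cyclic-model proofs (Theorems 8.7, 8.8, where `S⁰ = ℤ/n`) into a bound for `|S⁰| · r` over an ARBITRARY chart.
* `Data.c_not_signEq_of_b_rows`, `Data.b_not_signEq_of_c_row`, `Data.a_not_signEq_of_c_col` — the three laziness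
  lemmas at class level (Sep against (E) at a triple sharing the cross cell, with the lazy cell moved).
* `Data.sq_mul_card_le_of_b_rowsOn`, `Data.sq_mul_card_le_of_c_rowsOn`, `Data.sq_mul_card_le_of_c_colsOn` —
  LAZY ⟹ C3♯ for every chart: if the rows `j ∈ J₀` of `b` agree in class (resp. the rows of `c` are class-constant
  on `I₀`, resp. the columns ... rows `k ∈ K₀` of `c` agree in class) then `n² · |J₀| ≤ r · |S⁰|` (resp. `n² · |I₀|`,
  `n² · |K₀|`); `Data.cube_le_of_b_rows`: fully row-lazy `b` gives `n³ ≤ r · |S⁰|`, i.e. rank ≥ n³ — the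
  general-chart forms of the lazy-row lemma and of Theorem 8.7 (i), (iii) (`SoloInformedCyclicModel`).
References: this work §8.4c, §8.4d, §8.7 (o), §8.8; CohnUmans2013 Def. 12.
-/

open Pointwise

namespace Summit.MatrixMultiplication.MatrixMultiplication.Theorems.TwistedTPP

namespace FibreLines

/-- **Translate-averaging lemma.** If cells whose chart values differ by an element of `T - T` carry distinct
classes, then `|X| · |T| ≤ |R| · |S|` for every finset `S` containing all `φ x - t`, `t ∈ T`. [this work, §8.8] -/
theorem card_mul_card_le_of_sub_mem_sub {X G₀ R : Type*} [Fintype X] [DecidableEq X] [DecidableEq G₀]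
    [DecidableEq R] [Fintype R] [AddCommGroup G₀] (φ : X → G₀) (κ : X → R) (T S : Finset G₀)
    (hS : ∀ x, ∀ t ∈ T, φ x - t ∈ S)
    (h : ∀ x x', x ≠ x' → φ x - φ x' ∈ T - T → κ x ≠ κ x') :
    Fintype.card X * T.card ≤ Fintype.card R * S.card := by
  classical
  let Φ : X × G₀ → R × G₀ := fun p => (κ p.1, φ p.1 - p.2)
  have hmaps : ∀ p ∈ (Finset.univ : Finset X) ×ˢ T, Φ p ∈ (Finset.univ : Finset R) ×ˢ S := by
    rintro ⟨x, t⟩ hp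
    simp only [Finset.mem_product, Finset.mem_univ, true_and] at hp
    simp only [Φ, Finset.mem_product, Finset.mem_univ, true_and]
    exact hS x t hp
  have hinj : Set.InjOn Φ ↑((Finset.univ : Finset X) ×ˢ T) := by
    rintro ⟨x, t⟩ hp ⟨x', t'⟩ hp' hΦ
    simp only [Finset.coe_product, Finset.coe_univ, Set.mem_prod, Set.mem_univ, Finset.mem_coe,
      true_and] at hp hp'
    simp only [Φ, Prod.mk.injEq] at hΦ
    obtain ⟨hκ, hφ⟩ := hΦ
    have hdiff : φ x - φ x' = t - t' := sub_eq_sub_iff_sub_eq_sub.mp hφ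
    by_cases hxx : x = x'
    · subst hxx
      have ht : t = t' := by
        have h0 : t - t' = 0 := by rw [← hdiff, sub_self]
        exact sub_eq_zero.mp h0
      rw [ht]
    · exact absurd hκ (h x x' hxx (hdiff ▸ Finset.sub_mem_sub hp hp'))
  have hle := Finset.card_le_card_of_injOn Φ hmaps hinj
  simpa [Finset.card_product, Finset.card_univ] using hle

/-- The same with `S = S⁰` a finite group: `|X| · |T| ≤ |R| · |S⁰|`. -/
theorem card_mul_card_le_of_sub_mem_sub' {X G₀ R : Type*} [Fintype X] [DecidableEq X] [Fintype G₀]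
    [DecidableEq G₀] [DecidableEq R] [Fintype R] [AddCommGroup G₀] (φ : X → G₀) (κ : X → R) (T : Finset G₀)
    (h : ∀ x x', x ≠ x' → φ x - φ x' ∈ T - T → κ x ≠ κ x') :
    Fintype.card X * T.card ≤ Fintype.card R * Fintype.card G₀ := by
  have := card_mul_card_le_of_sub_mem_sub φ κ T Finset.univ (fun x t _ => Finset.mem_univ _) h
  simpa [Finset.card_univ] using this

variable {ι G : Type*} [AddCommGroup G]

/-! ### The three laziness lemmas (class level) -/

/-- Rows `j, j'` of `b` agree in class at column `k` and `Sep(τ → τ')`, `τ = (i,j,k)`, `τ' = (i',j',k')`: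
then `c(k',i') ≁ c(k,i)` (move the lazy cell: (E) at `(i,j,k)` with `b(j,k) ∼ b(j',k)`). -/
theorem Data.c_not_signEq_of_b_rows (D : Data ι G) {i j k i' j' k' : ι}
    (hb : SignEq (D.b j' k) (D.b j k)) (h : D.Sep i j k i' j' k') :
    ¬ SignEq (D.c k i) (D.c k' i') := by
  intro hc
  rw [Data.sep_iff_not_adm] at h
  exact h (((D.adm_eqn i j k).of_signEq_mid hb.symm).of_signEq_right hc)

/-- Row `k'` of `c` agrees in class at columns `i, i''` and `Sep((i,j',k) → (i'',j,k'))`: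
then `b(j,k) ≁ b(j',k')` (move the lazy cell: (E) at `(i,j',k')`). -/
theorem Data.b_not_signEq_of_c_row (D : Data ι G) {i j k i'' j' k' : ι}
    (hc : SignEq (D.c k' i) (D.c k' i'')) (h : D.Sep i j' k i'' j k') :
    ¬ SignEq (D.b j' k') (D.b j k) := by
  intro hb
  rw [Data.sep_iff_not_adm] at h
  exact h (((D.adm_eqn i j' k').of_signEq_mid hb).of_signEq_right hc)

/-- Column `i'` of `c` agrees in class at rows `k, k''` and `Sep((i,j,k'') → (i',j',k))`:
then `a(i,j) ≁ a(i',j')` (move the lazy cell: (E) at `(i',j',k'')`). -/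
theorem Data.a_not_signEq_of_c_col (D : Data ι G) {i j k i' j' k'' : ι}
    (hc : SignEq (D.c k'' i') (D.c k i')) (h : D.Sep i j k'' i' j' k) :
    ¬ SignEq (D.a i' j') (D.a i j) := by
  intro ha
  rw [Data.sep_iff_not_adm] at h
  exact h (((D.adm_eqn i' j' k'').of_signEq_left ha).of_signEq_right hc)

/-! ### Charts, full separation, and LAZY ⟹ C3♯ -/

/-- A flat chart `(f, g, l)` into the even part `S⁰`; the fibre map is `F(i,j,k) = f i + g j + l k`. -/
structure Chart (ι G₀ : Type*) where
  f : ι → G₀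
  g : ι → G₀
  l : ι → G₀

/-- The fibre map of a chart. -/
def Chart.F {G₀ : Type*} [Add G₀] (Φ : Chart ι G₀) (i j k : ι) : G₀ := Φ.f i + Φ.g j + Φ.l k

/-- Full separation: every ordered pair of distinct triples in one fibre of the chart is separated. -/
def Data.SepAll {G₀ : Type*} [Add G₀] (D : Data ι G) (Φ : Chart ι G₀) : Prop :=
  ∀ i j k i' j' k', Φ.F i j k = Φ.F i' j' k' → (i, j, k) ≠ (i', j', k') → D.Sep i j k i' j' k'

variable {G₀ R : Type*} [AddCommGroup G₀]

/-- **Row-lazy `b` on `J₀` ⟹ `n² · |J₀| ≤ r · |S⁰|`.** If the rows `j ∈ J₀` of `b` pairwise agree in class,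
the cells of `c` whose chart values `f i + l k` differ by an element of `g(J₀) - g(J₀)` carry distinct classes,
and the averaging lemma applies. (General-chart lazy-row lemma.) [this work, §8.8] -/
theorem Data.sq_mul_card_le_of_b_rowsOn [Fintype ι] [DecidableEq ι] [Fintype G₀] [DecidableEq G₀]
    [Fintype R] [DecidableEq R] (D : Data ι G) (Φ : Chart ι G₀) (κ : G → R)
    (hκ : ∀ x y, κ x = κ y → SignEq x y) (hsep : D.SepAll Φ) (J₀ : Finset ι)
    (hb : ∀ j ∈ J₀, ∀ j' ∈ J₀, ∀ k, SignEq (D.b j' k) (D.b j k)) :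
    Fintype.card ι ^ 2 * J₀.card ≤ Fintype.card R * Fintype.card G₀ := by
  classical
  -- g is injective on J₀
  have hg : Set.InjOn Φ.g ↑J₀ := by
    intro j hj j' hj' hgg
    by_contra hne
    have hF : Φ.F j j j = Φ.F j j' j := by simp [Chart.F, hgg]
    have hs := hsep j j j j j' j hF (by simp [hne])
    exact D.c_not_signEq_of_b_rows (hb j hj j' hj' j) hs (SignEq.refl _)
  have hT : (J₀.image Φ.g).card = J₀.card := Finset.card_image_of_injOn hg
  -- averaging over the c-cells (k, i) with chart f i + l k
  have key := card_mul_card_le_of_sub_mem_sub' (X := ι × ι) (fun z => Φ.f z.2 + Φ.l z.1)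
    (fun z => κ (D.c z.1 z.2)) (J₀.image Φ.g) ?_
  · simpa [Fintype.card_prod, hT, pow_two] using key
  · rintro ⟨k, i⟩ ⟨k', i'⟩ hne hmem hκeq
    rw [Finset.mem_sub] at hmem
    obtain ⟨t, ht, t', ht', htt⟩ := hmem
    rw [Finset.mem_image] at ht ht'
    obtain ⟨j, hj, rfl⟩ := ht
    obtain ⟨j', hj', rfl⟩ := ht'
    -- τ = (i, j', k), τ' = (i', j, k') lie in one fibre
    have hF : Φ.F i j' k = Φ.F i' j k' := by
      simp only [Chart.F]
      have e : Φ.f i + Φ.l k - (Φ.f i' + Φ.l k') = Φ.g j - Φ.g j' := by simpa using htt.symm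
      have e2 : Φ.f i + Φ.g j' + Φ.l k - (Φ.f i' + Φ.g j + Φ.l k') =
          (Φ.f i + Φ.l k - (Φ.f i' + Φ.l k')) - (Φ.g j - Φ.g j') := by abel
      rw [← sub_eq_zero, e2, e, sub_self]
    have hneq : (i, j', k) ≠ (i', j, k') := by
      intro heq
      simp only [Prod.mk.injEq] at heq
      exact hne (by rw [heq.1, heq.2.2])
    have hs := hsep i j' k i' j k' hF hneq
    exact D.c_not_signEq_of_b_rows (hb j' hj' j hj k) hs (hκ _ _ hκeq)

/-- Fully row-lazy `b` (all rows agree in class) ⟹ `n³ ≤ r · |S⁰|`: rank ≥ n³, C3♯ for every chart. -/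
theorem Data.cube_le_of_b_rows [Fintype ι] [DecidableEq ι] [Fintype G₀] [DecidableEq G₀]
    [Fintype R] [DecidableEq R] (D : Data ι G) (Φ : Chart ι G₀) (κ : G → R)
    (hκ : ∀ x y, κ x = κ y → SignEq x y) (hsep : D.SepAll Φ)
    (hb : ∀ j j' k, SignEq (D.b j' k) (D.b j k)) :
    Fintype.card ι ^ 3 ≤ Fintype.card R * Fintype.card G₀ := by
  have := D.sq_mul_card_le_of_b_rowsOn Φ κ hκ hsep Finset.univ (fun j _ j' _ k => hb j j' k)
  simpa [Finset.card_univ, pow_succ] using this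

/-- **Rows of `c` class-constant on `I₀` ⟹ `n² · |I₀| ≤ r · |S⁰|`** (general-chart Theorem 8.7 (iii) / (B4)):
the cells of `b` whose difference chart `l k - g j` differs by an element of `f(I₀) - f(I₀)` carry distinct
classes. [this work, §8.8] -/
theorem Data.sq_mul_card_le_of_c_rowsOn [Fintype ι] [DecidableEq ι] [Fintype G₀] [DecidableEq G₀]
    [Fintype R] [DecidableEq R] (D : Data ι G) (Φ : Chart ι G₀) (κ : G → R)
    (hκ : ∀ x y, κ x = κ y → SignEq x y) (hsep : D.SepAll Φ) (I₀ : Finset ι)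
    (hc : ∀ i ∈ I₀, ∀ i'' ∈ I₀, ∀ k, SignEq (D.c k i) (D.c k i'')) :
    Fintype.card ι ^ 2 * I₀.card ≤ Fintype.card R * Fintype.card G₀ := by
  classical
  have hf : Set.InjOn Φ.f ↑I₀ := by
    intro i hi i'' hi'' hff
    by_contra hne
    have hF : Φ.F i i i = Φ.F i'' i i := by simp [Chart.F, hff]
    have hs := hsep i i i i'' i i hF (by simp [hne])
    exact D.b_not_signEq_of_c_row (hc i hi i'' hi'' i) hs (SignEq.refl _)
  have hT : (I₀.image Φ.f).card = I₀.card := Finset.card_image_of_injOn hf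
  have key := card_mul_card_le_of_sub_mem_sub' (X := ι × ι) (fun z => Φ.l z.2 - Φ.g z.1)
    (fun z => κ (D.b z.1 z.2)) (I₀.image Φ.f) ?_
  · simpa [Fintype.card_prod, hT, pow_two] using key
  · rintro ⟨j, k⟩ ⟨j', k'⟩ hne hmem hκeq
    rw [Finset.mem_sub] at hmem
    obtain ⟨t, ht, t', ht', htt⟩ := hmem
    rw [Finset.mem_image] at ht ht'
    obtain ⟨i'', hi'', rfl⟩ := ht
    obtain ⟨i, hi, rfl⟩ := ht'
    -- d(j,k) - d(j',k') = f i'' - f i  ⟹  τ = (i, j', k), τ' = (i'', j, k') in one fibre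
    have hF : Φ.F i j' k = Φ.F i'' j k' := by
      simp only [Chart.F]
      have e : Φ.l k - Φ.g j - (Φ.l k' - Φ.g j') = Φ.f i'' - Φ.f i := by simpa using htt.symm
      have e2 : Φ.f i + Φ.g j' + Φ.l k - (Φ.f i'' + Φ.g j + Φ.l k') =
          (Φ.l k - Φ.g j - (Φ.l k' - Φ.g j')) - (Φ.f i'' - Φ.f i) := by abel
      rw [← sub_eq_zero, e2, e, sub_self]
    have hneq : (i, j', k) ≠ (i'', j, k') := by
      intro heq
      simp only [Prod.mk.injEq] at heq
      exact hne (by rw [heq.2.1, heq.2.2])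
    have hs := hsep i j' k i'' j k' hF hneq
    exact D.b_not_signEq_of_c_row (hc i hi i'' hi'' k') hs ((hκ _ _ hκeq).symm)

/-- **Rows `k ∈ K₀` of `c` pairwise agreeing in class ⟹ `n² · |K₀| ≤ r · |S⁰|`** (general-chart
Theorem 8.7 (i)): the cells of `a` whose chart values `f i + g j` differ by an element of `l(K₀) - l(K₀)` carry
distinct classes. [this work, §8.8] -/
theorem Data.sq_mul_card_le_of_c_colsOn [Fintype ι] [DecidableEq ι] [Fintype G₀] [DecidableEq G₀]
    [Fintype R] [DecidableEq R] (D : Data ι G) (Φ : Chart ι G₀) (κ : G → R)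
    (hκ : ∀ x y, κ x = κ y → SignEq x y) (hsep : D.SepAll Φ) (K₀ : Finset ι)
    (hc : ∀ k ∈ K₀, ∀ k'' ∈ K₀, ∀ i, SignEq (D.c k'' i) (D.c k i)) :
    Fintype.card ι ^ 2 * K₀.card ≤ Fintype.card R * Fintype.card G₀ := by
  classical
  have hl : Set.InjOn Φ.l ↑K₀ := by
    intro k hk k'' hk'' hll
    by_contra hne
    have hF : Φ.F k k k = Φ.F k k k'' := by simp [Chart.F, hll]
    have hs := hsep k k k k k k'' hF (by simp [hne])
    exact D.a_not_signEq_of_c_col (hc k'' hk'' k hk k) hs (SignEq.refl _)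
  have hT : (K₀.image Φ.l).card = K₀.card := Finset.card_image_of_injOn hl
  have key := card_mul_card_le_of_sub_mem_sub' (X := ι × ι) (fun x => Φ.f x.1 + Φ.g x.2)
    (fun x => κ (D.a x.1 x.2)) (K₀.image Φ.l) ?_
  · simpa [Fintype.card_prod, hT, pow_two] using key
  · rintro ⟨i', j'⟩ ⟨i, j⟩ hne hmem hκeq
    rw [Finset.mem_sub] at hmem
    obtain ⟨t, ht, t', ht', htt⟩ := hmem
    rw [Finset.mem_image] at ht ht'
    obtain ⟨k'', hk'', rfl⟩ := ht
    obtain ⟨k, hk, rfl⟩ := ht'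
    -- a⁰(i',j') - a⁰(i,j) = l k'' - l k  ⟹  τ = (i, j, k''), τ' = (i', j', k) in one fibre
    have hF : Φ.F i j k'' = Φ.F i' j' k := by
      simp only [Chart.F]
      have e : Φ.f i' + Φ.g j' - (Φ.f i + Φ.g j) = Φ.l k'' - Φ.l k := by simpa using htt.symm
      have e2 : Φ.f i + Φ.g j + Φ.l k'' - (Φ.f i' + Φ.g j' + Φ.l k) =
          (Φ.l k'' - Φ.l k) - (Φ.f i' + Φ.g j' - (Φ.f i + Φ.g j)) := by abel
      rw [← sub_eq_zero, e2, e, sub_self]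
    have hneq : (i, j, k'') ≠ (i', j', k) := by
      intro heq
      simp only [Prod.mk.injEq] at heq
      exact hne (by rw [heq.1, heq.2.1])
    have hs := hsep i j k'' i' j' k hF hneq
    exact D.a_not_signEq_of_c_col (hc k hk k'' hk'' i') hs (hκ _ _ hκeq)

end FibreLines

end Summit.MatrixMultiplication.MatrixMultiplication.Theorems.TwistedTPP
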